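import Summits.ResolutionOfSingularities.ResolutionOfSingularities.Theorems.PurelyInseparableDim4EquimultipleScope
import Literature.AlgebraicGeometry.Resolution.HasseSchmidtDerivatives
import HarnessLib
import HarnessLib.Audit.Tags

/-!
# Purely inseparable dim 4 — Hasse derivatives across one point blow-up: the transfer identity

The algebraic heart of the free-tail lemma (FT, `FreeTail.NoIsolatedFreeTailAt p p`; CARD I-7-2),
step (1) of the route announced by p-5 (18:36Z).  Fix a chart `j`, a translation `b`, and let
`σ = σ_{j,b}` be the substitution of the frame's point blow-up, `σ(y)_i = y_j (y_i + b_i)` (`i ≠ j`),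
`σ(y)_j = y_j`, realised by any `K`-algebra endomorphism `φ` of `K[y₁..y₄]` with these values on the
variables (`pointTransform = y_j^{-q} · φ F`).  For the tree's Hasse–Schmidt derivatives `D^{(α)}`
(`Resolution.hasseDeriv`, the coefficient of `u^α` in `f(x + u)`):

* `taylor_identity` — the MASTER IDENTITY `F(σ(y) + y_j·ĥ(u)) = (φ F)(y + δ(u))` in `K[y][u]` with
  `δ = (u_i)_{i ≠ j}`, `δ_j = y_j u_j` and `ĥ_j = u_j`, `ĥ_i = u_i + (y_i + b_i) u_j + u_i u_j`: two
  `K`-algebra maps `K[x] → K[y][u]` that agree on the variables (`σ(y + δ(u)) = σ(y) + y_j ĥ(u)`).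
* `lhs_expand`, `rhs_expand`, `coeff_taylor_identity` — its `u^γ`-coefficient:
  `Σ_α φ(D^{(α)}F) · y_j^{|α|} · [u^γ] ĥ^α = D^{(γ)}(φ F) · y_j^{γ_j}`.
* `hvProd_triangular` — `ĥ^α = u^α +` (monomials `u^γ` with `(|γ|, γ_j) >_lex (|α|, α_j)`): the
  linear system is unitriangular.
* **`map_hasseDeriv_mul_X_pow_mem_span`** — hence, by induction on `(|γ|, γ_j)`, for every `γ ≠ 0`:
  **`φ(D^{(γ)}F) · y_j^{|γ|} ∈ ⟨D^{(β)}(φ F) : 0 < |β| ≤ |γ|⟩`** — the Hasse derivatives of `F` of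
  order `< q`, pulled back along the blow-up, are controlled by those of the transform, at the price
  of the factor `y_j^{|γ|}` (the exceptional divisor).

Pure commutative algebra over any field (no characteristic hypothesis).  The characteristic-`p` inputs
(`φ F = y_j^p · T` and `D^{(β)}(y_j^p T) = y_j^p D^{(β)}T` for `|β| < p`) and the arc argument are the
sequel (`PurelyInseparableDim4FreeTailLemma`).  OURS; nothing here proves FT, `NoIsolatedTrap 3 3`, or
resolution in dimension `≥ 4` / characteristic `p`.  Supports stmt-ResolutionOfSingularities-16155 (helper).
-/

set_option linter.dupNamespace false -- mandated namespace of this single-conjunct summit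

namespace Summit.ResolutionOfSingularities.ResolutionOfSingularities.Theorems.PIDim4

namespace BlowupHasse

open MvPolynomial Finset
open Literature.AlgebraicGeometry

variable {K : Type} [Field K]

/-! ## 1. The master identity -/

/-- **Master identity.**  For a `K`-algebra endomorphism `φ` of `K[y]` realising the blow-up
substitution `σ_{j,b}` and every `F`:  `F(σ(y) + y_j·ĥ(u)) = (φ F)(y + δ(u))` in `K[y][u]`
(outer variables `X i` = `u_i`, constants `C (X i)` = `y_i`), where `ĥ_j = u_j`,
`ĥ_i = u_i + (y_i + b_i) u_j + u_i u_j` (`i ≠ j`) and `δ_j = y_j u_j`, `δ_i = u_i`: both sides are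
`K`-algebra maps in `F` agreeing on the variables, since `σ(y + δ(u)) = σ(y) + y_j ĥ(u)`. [folklore] -/
theorem taylor_identity (j : Fin 4) (b : Fin 4 → K)
    (φ : MvPolynomial (Fin 4) K →ₐ[K] MvPolynomial (Fin 4) K) (hφj : φ (X j) = X j)
    (hφi : ∀ i, i ≠ j → φ (X i) = X j * (X i + C (b i))) (F : MvPolynomial (Fin 4) K) :
    aeval (fun i => C (X j) * (if i = j then (X j : MvPolynomial (Fin 4) (MvPolynomial (Fin 4) K))
        else X i + C (X i + C (b i)) * X j + X i * X j))
      (MvPolynomial.map (φ : MvPolynomial (Fin 4) K →+* MvPolynomial (Fin 4) K)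
        (Resolution.taylor K F)) =
    aeval (fun i => if i = j then C (X j) * (X j : MvPolynomial (Fin 4) (MvPolynomial (Fin 4) K))
        else X i) (Resolution.taylor K (φ F)) := by
  have hφj' : (φ : MvPolynomial (Fin 4) K →+* MvPolynomial (Fin 4) K) (X j) = X j := hφj
  have hφi' : ∀ i, i ≠ j →
      (φ : MvPolynomial (Fin 4) K →+* MvPolynomial (Fin 4) K) (X i) = X j * (X i + C (b i)) := hφi
  set h : Fin 4 → MvPolynomial (Fin 4) (MvPolynomial (Fin 4) K) := fun i => C (X j) *
    (if i = j then (X j : MvPolynomial (Fin 4) (MvPolynomial (Fin 4) K))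
      else X i + C (X i + C (b i)) * X j + X i * X j) with hh
  set δ : Fin 4 → MvPolynomial (Fin 4) (MvPolynomial (Fin 4) K) := fun i =>
    if i = j then C (X j) * (X j : MvPolynomial (Fin 4) (MvPolynomial (Fin 4) K)) else X i with hδ
  let L₁ : MvPolynomial (Fin 4) K →ₐ[K] MvPolynomial (Fin 4) (MvPolynomial (Fin 4) K) :=
    ((aeval h).restrictScalars K).comp ((mapAlgHom φ).comp (Resolution.taylor K))
  let L₂ : MvPolynomial (Fin 4) K →ₐ[K] MvPolynomial (Fin 4) (MvPolynomial (Fin 4) K) :=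
    ((aeval δ).restrictScalars K).comp ((Resolution.taylor K).comp φ)
  have key : L₁ = L₂ := by
    refine MvPolynomial.algHom_ext fun i => ?_
    simp only [L₁, L₂, AlgHom.comp_apply, AlgHom.coe_restrictScalars', Resolution.taylor_X,
      mapAlgHom_apply, map_add, map_C, map_X, aeval_X, aeval_C, algebraMap_eq]
    by_cases hij : i = j
    · subst hij
      simp only [hh, hδ, if_true, hφj', hφj, Resolution.taylor_X, map_add, aeval_C,
        algebraMap_eq, aeval_X]
    · simp only [hh, hδ, if_neg hij, hφi' i hij, hφi i hij, map_mul, map_add,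
        Resolution.taylor_X, Resolution.taylor_C, aeval_C, algebraMap_eq, aeval_X, if_true]
      ring
  have := congrArg (fun L => L F) key
  simpa [L₁, L₂] using this


/-! ## 2. Both sides expanded; the `u^γ`-coefficient -/

/-- `|α| = Σᵢ αᵢ` over `Fin 4`. [folklore] -/
theorem degree_eq_sum_univ (α : Fin 4 →₀ ℕ) : α.degree = ∑ i, α i := by
  rw [Finsupp.degree_apply]
  exact Finset.sum_subset (Finset.subset_univ _) fun i _ hi => Finsupp.notMem_support_iff.mp hi

/-- Left side of the master identity, expanded over the Taylor support of `F`: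
`F(σ(y) + y_j ĥ(u)) = Σ_α φ(D^{(α)}F)·y_j^{|α|}·ĥ(u)^α`. [folklore] -/
theorem lhs_expand (j : Fin 4) (b : Fin 4 → K)
    (φ : MvPolynomial (Fin 4) K →ₐ[K] MvPolynomial (Fin 4) K) (F : MvPolynomial (Fin 4) K) :
    aeval (fun i => C (X j) * (if i = j then (X j : MvPolynomial (Fin 4) (MvPolynomial (Fin 4) K))
        else X i + C (X i + C (b i)) * X j + X i * X j))
      (MvPolynomial.map (φ : MvPolynomial (Fin 4) K →+* MvPolynomial (Fin 4) K)
        (Resolution.taylor K F)) =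
    ∑ α ∈ (Resolution.taylor K F).support,
      C (φ (Resolution.hasseDeriv K α F) * X j ^ α.degree) *
        ∏ i, (if i = j then (X j : MvPolynomial (Fin 4) (MvPolynomial (Fin 4) K))
          else X i + C (X i + C (b i)) * X j + X i * X j) ^ α i := by
  conv_lhs => rw [(Resolution.taylor K F).as_sum, map_sum, map_sum]
  refine Finset.sum_congr rfl fun α _ => ?_
  rw [map_monomial, aeval_monomial, algebraMap_eq, Finsupp.prod_fintype _ _ fun i => pow_zero _]
  simp only [mul_pow, Finset.prod_mul_distrib, Finset.prod_pow_eq_pow_sum, ← degree_eq_sum_univ,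
    map_mul, map_pow, Resolution.hasseDeriv_apply]
  rw [mul_assoc]
  rfl

/-- Right side of the master identity, expanded over the Taylor support of `G = φ F`:
`G(y + δ(u)) = Σ_β D^{(β)}G · y_j^{β_j} · u^β`. [folklore] -/
theorem rhs_expand (j : Fin 4) (G : MvPolynomial (Fin 4) K) :
    aeval (fun i => if i = j then C (X j) * (X j : MvPolynomial (Fin 4) (MvPolynomial (Fin 4) K))
        else X i) (Resolution.taylor K G) =
    ∑ β ∈ (Resolution.taylor K G).support,
      C (Resolution.hasseDeriv K β G * X j ^ (β j)) * monomial β 1 := by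
  conv_lhs => rw [(Resolution.taylor K G).as_sum, map_sum]
  refine Finset.sum_congr rfl fun β _ => ?_
  have hsplit : ∀ i ∈ (Finset.univ : Finset (Fin 4)),
      (if i = j then C (X j) * (X j : MvPolynomial (Fin 4) (MvPolynomial (Fin 4) K)) else X i) ^ β i =
      (if i = j then C (X j) ^ β i else 1) * X i ^ β i := by
    intro i _
    split_ifs with h
    · subst h; rw [mul_pow]
    · rw [one_mul]
  have hprod : ∏ i, (if i = j then C (X j) * (X j : MvPolynomial (Fin 4) (MvPolynomial (Fin 4) K))
      else X i) ^ β i = C (X j) ^ β j * ∏ i, (X i : MvPolynomial (Fin 4) (MvPolynomial (Fin 4) K)) ^ β i := by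
    rw [Finset.prod_congr rfl hsplit, Finset.prod_mul_distrib, Finset.prod_ite_eq' Finset.univ j,
      if_pos (Finset.mem_univ j)]
  rw [aeval_monomial, algebraMap_eq, Finsupp.prod_fintype _ _ fun i => pow_zero _, hprod,
    Resolution.hasseDeriv_apply, map_mul, map_pow, monomial_eq, C_1, one_mul,
    Finsupp.prod_fintype _ _ fun i => pow_zero _, mul_assoc]

/-- **The `u^γ`-coefficient of the master identity**:
`Σ_α φ(D^{(α)}F)·y_j^{|α|}·[u^γ]ĥ^α = D^{(γ)}(φF)·y_j^{γ_j}`. [folklore] -/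
theorem coeff_taylor_identity (j : Fin 4) (b : Fin 4 → K)
    (φ : MvPolynomial (Fin 4) K →ₐ[K] MvPolynomial (Fin 4) K) (hφj : φ (X j) = X j)
    (hφi : ∀ i, i ≠ j → φ (X i) = X j * (X i + C (b i))) (F : MvPolynomial (Fin 4) K)
    (γ : Fin 4 →₀ ℕ) :
    ∑ α ∈ (Resolution.taylor K F).support,
      (φ (Resolution.hasseDeriv K α F) * X j ^ α.degree) *
        coeff γ (∏ i, (if i = j then (X j : MvPolynomial (Fin 4) (MvPolynomial (Fin 4) K))
          else X i + C (X i + C (b i)) * X j + X i * X j) ^ α i) =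
    Resolution.hasseDeriv K γ (φ F) * X j ^ (γ j) := by
  classical
  have h := congrArg (coeff γ) (taylor_identity j b φ hφj hφi F)
  rw [lhs_expand, rhs_expand, coeff_sum, coeff_sum] at h
  simp only [coeff_C_mul] at h
  rw [h]
  simp only [coeff_monomial, mul_ite, mul_one, mul_zero]
  rw [Finset.sum_ite_eq']
  split_ifs with hγ
  · rfl
  · rw [Resolution.hasseDeriv_apply, notMem_support_iff.mp hγ, zero_mul]

/-! ## 3. Triangularity of `ĥ^α` -/

/-- products of triangular pairs are triangular (key `(|γ|, γ_j)` is additive and lex-ordered). [folklore] -/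
private theorem tri_mul (j : Fin 4) {f g : MvPolynomial (Fin 4) (MvPolynomial (Fin 4) K)}
    {α β : Fin 4 →₀ ℕ}
    (hf : coeff α f = 1 ∧ ∀ γ, coeff γ f ≠ 0 → γ ≠ α →
      (α.degree < γ.degree ∨ (α.degree = γ.degree ∧ α j < γ j)))
    (hg : coeff β g = 1 ∧ ∀ γ, coeff γ g ≠ 0 → γ ≠ β →
      (β.degree < γ.degree ∨ (β.degree = γ.degree ∧ β j < γ j))) :
    coeff (α + β) (f * g) = 1 ∧ ∀ γ, coeff γ (f * g) ≠ 0 → γ ≠ α + β →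
      ((α + β).degree < γ.degree ∨ ((α + β).degree = γ.degree ∧ (α + β) j < γ j)) := by
  classical
  constructor
  · rw [coeff_mul, Finset.sum_eq_single (α, β)]
    · rw [hf.1, hg.1, mul_one]
    · rintro ⟨γ₁, γ₂⟩ hmem hne
      rw [Finset.HasAntidiagonal.mem_antidiagonal] at hmem
      by_contra hterm
      obtain ⟨h1, h2⟩ := mul_ne_zero_iff.mp hterm
      have hd : γ₁.degree + γ₂.degree = α.degree + β.degree := by
        rw [← map_add Finsupp.degree, ← map_add Finsupp.degree, hmem]
      have hjj : γ₁ j + γ₂ j = α j + β j := by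
        have := DFunLike.congr_fun hmem j
        simpa only [Finsupp.add_apply] using this
      have hne1 : γ₁ ≠ α := by
        rintro rfl
        exact hne (Prod.ext rfl (add_left_cancel hmem))
      have hne2 : γ₂ ≠ β := by
        rintro rfl
        exact hne (Prod.ext (add_right_cancel hmem) rfl)
      rcases hf.2 γ₁ h1 hne1 with k1 | k1 <;> rcases hg.2 γ₂ h2 hne2 with k2 | k2 <;> omega
    · intro h
      exact (h (Finset.HasAntidiagonal.mem_antidiagonal.mpr rfl)).elim
  · intro γ hγ hne
    rw [coeff_mul] at hγ
    obtain ⟨⟨γ₁, γ₂⟩, hmem, hterm⟩ := Finset.exists_ne_zero_of_sum_ne_zero hγ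
    rw [Finset.HasAntidiagonal.mem_antidiagonal] at hmem
    obtain ⟨h1, h2⟩ := mul_ne_zero_iff.mp hterm
    have hd : γ₁.degree + γ₂.degree = γ.degree := by rw [← map_add Finsupp.degree, hmem]
    have hjj : γ₁ j + γ₂ j = γ j := by
      have := DFunLike.congr_fun hmem j
      simpa only [Finsupp.add_apply] using this
    rw [map_add, Finsupp.add_apply]
    rcases eq_or_ne γ₁ α with rfl | hne1 <;> rcases eq_or_ne γ₂ β with rfl | hne2
    · exact absurd hmem.symm hne
    · rcases hg.2 γ₂ h2 hne2 with k | k <;> omega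
    · rcases hf.2 γ₁ h1 hne1 with k | k <;> omega
    · rcases hf.2 γ₁ h1 hne1 with k1 | k1 <;> rcases hg.2 γ₂ h2 hne2 with k2 | k2 <;> omega

/-- `1` is triangular with exponent `0`. [folklore] -/
private theorem tri_one (j : Fin 4) :
    coeff (0 : Fin 4 →₀ ℕ) (1 : MvPolynomial (Fin 4) (MvPolynomial (Fin 4) K)) = 1 ∧
      ∀ γ, coeff γ (1 : MvPolynomial (Fin 4) (MvPolynomial (Fin 4) K)) ≠ 0 → γ ≠ 0 →
        ((0 : Fin 4 →₀ ℕ).degree < γ.degree ∨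
          ((0 : Fin 4 →₀ ℕ).degree = γ.degree ∧ (0 : Fin 4 →₀ ℕ) j < γ j)) := by
  classical
  refine ⟨coeff_zero_one, fun γ hγ hne => ?_⟩
  rw [coeff_one, if_neg (Ne.symm hne)] at hγ
  exact absurd rfl hγ

/-- powers of a triangular element are triangular. [folklore] -/
private theorem tri_pow (j : Fin 4) {f : MvPolynomial (Fin 4) (MvPolynomial (Fin 4) K)}
    {α : Fin 4 →₀ ℕ}
    (hf : coeff α f = 1 ∧ ∀ γ, coeff γ f ≠ 0 → γ ≠ α →
      (α.degree < γ.degree ∨ (α.degree = γ.degree ∧ α j < γ j))) (n : ℕ) :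
    coeff (n • α) (f ^ n) = 1 ∧ ∀ γ, coeff γ (f ^ n) ≠ 0 → γ ≠ n • α →
      ((n • α).degree < γ.degree ∨ ((n • α).degree = γ.degree ∧ (n • α) j < γ j)) := by
  induction n with
  | zero => rw [pow_zero, zero_smul]; exact tri_one j
  | succ n ih => rw [pow_succ, succ_nsmul]; exact tri_mul j ih hf

/-- the components `ĥ_i` are triangular with exponent `e_i`. [folklore] -/
private theorem tri_hv (j : Fin 4) (b : Fin 4 → K) (i : Fin 4) :
    coeff (Finsupp.single i 1) (if i = j then (X j : MvPolynomial (Fin 4) (MvPolynomial (Fin 4) K))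
        else X i + C (X i + C (b i)) * X j + X i * X j) = 1 ∧
      ∀ γ, coeff γ (if i = j then (X j : MvPolynomial (Fin 4) (MvPolynomial (Fin 4) K))
          else X i + C (X i + C (b i)) * X j + X i * X j) ≠ 0 → γ ≠ Finsupp.single i 1 →
        ((Finsupp.single i 1).degree < γ.degree ∨
          ((Finsupp.single i 1).degree = γ.degree ∧ (Finsupp.single i 1) j < γ j)) := by
  classical
  by_cases hij : i = j
  · subst hij
    simp only [if_true]
    refine ⟨by rw [coeff_X, if_pos rfl], fun γ hγ hne => ?_⟩
    rw [coeff_X, if_neg (Ne.symm hne)] at hγ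
    exact absurd rfl hγ
  · simp only [if_neg hij]
    have hform : (X i : MvPolynomial (Fin 4) (MvPolynomial (Fin 4) K)) +
        C (X i + C (b i)) * X j + X i * X j =
        monomial (Finsupp.single i 1) 1 + monomial (Finsupp.single j 1) (X i + C (b i)) +
          monomial (Finsupp.single i 1 + Finsupp.single j 1) 1 := by
      simp only [X, C_mul_monomial, monomial_mul, mul_one]
    rw [hform]
    have hne1 : Finsupp.single j 1 ≠ Finsupp.single i 1 := fun h =>
      hij ((Finsupp.single_left_inj one_ne_zero).mp h).symm
    have hne2 : Finsupp.single i 1 + Finsupp.single j 1 ≠ Finsupp.single i 1 := by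
      intro h
      have := DFunLike.congr_fun h j
      simp only [Finsupp.add_apply, Finsupp.single_eq_same, Finsupp.single_apply, if_neg hij] at this
      omega
    refine ⟨?_, fun γ hγ hne => ?_⟩
    · simp only [coeff_add, coeff_monomial, if_true, if_neg hne1, if_neg hne2, add_zero]
    · simp only [coeff_add, coeff_monomial] at hγ
      by_cases h1 : Finsupp.single j 1 = γ
      · subst h1
        right
        simp only [Finsupp.degree_single, Finsupp.single_eq_same, Finsupp.single_apply, if_neg hij,
          true_and]
        omega
      · by_cases h2 : Finsupp.single i 1 + Finsupp.single j 1 = γ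
        · subst h2
          left
          rw [map_add, Finsupp.degree_single, Finsupp.degree_single]
          omega
        · rw [if_neg (Ne.symm hne), if_neg h1, if_neg h2, add_zero, add_zero] at hγ
          exact absurd rfl hγ

/-- **`ĥ^α` is unitriangular**: `[u^α] ĥ^α = 1`, and every other monomial `u^γ` of `ĥ^α` has
`(|γ|, γ_j) >_lex (|α|, α_j)`. [folklore] -/
theorem hvProd_triangular (j : Fin 4) (b : Fin 4 → K) (α : Fin 4 →₀ ℕ) :
    coeff α (∏ i, (if i = j then (X j : MvPolynomial (Fin 4) (MvPolynomial (Fin 4) K))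
        else X i + C (X i + C (b i)) * X j + X i * X j) ^ α i) = 1 ∧
      ∀ γ, coeff γ (∏ i, (if i = j then (X j : MvPolynomial (Fin 4) (MvPolynomial (Fin 4) K))
          else X i + C (X i + C (b i)) * X j + X i * X j) ^ α i) ≠ 0 → γ ≠ α →
        (α.degree < γ.degree ∨ (α.degree = γ.degree ∧ α j < γ j)) := by
  classical
  -- over an arbitrary finset of indices first
  have key : ∀ s : Finset (Fin 4),
      coeff (∑ i ∈ s, α i • Finsupp.single i 1)
          (∏ i ∈ s, (if i = j then (X j : MvPolynomial (Fin 4) (MvPolynomial (Fin 4) K))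
            else X i + C (X i + C (b i)) * X j + X i * X j) ^ α i) = 1 ∧
        ∀ γ, coeff γ (∏ i ∈ s, (if i = j then (X j : MvPolynomial (Fin 4) (MvPolynomial (Fin 4) K))
            else X i + C (X i + C (b i)) * X j + X i * X j) ^ α i) ≠ 0 →
          γ ≠ ∑ i ∈ s, α i • Finsupp.single i 1 →
          ((∑ i ∈ s, α i • Finsupp.single i 1).degree < γ.degree ∨
            ((∑ i ∈ s, α i • Finsupp.single i 1).degree = γ.degree ∧
              (∑ i ∈ s, α i • Finsupp.single i 1) j < γ j)) := by
    intro s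
    induction s using Finset.induction_on with
    | empty => rw [Finset.sum_empty, Finset.prod_empty]; exact tri_one j
    | insert i s hi ih =>
      rw [Finset.sum_insert hi, Finset.prod_insert hi]
      exact tri_mul j (tri_pow j (tri_hv j b i) (α i)) ih
  have hα : ∑ i ∈ Finset.univ, α i • Finsupp.single i 1 = α := by
    simp only [Finsupp.smul_single_one, Finsupp.univ_sum_single]
  have h := key Finset.univ
  rw [hα] at h
  exact h

/-! ## 4. The transfer: `y_j^{|γ|} · σ*(D^{(γ)}F) ∈ ⟨D^{(β)}(σ*F) : 0 < |β| ≤ |γ|⟩` -/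

/-- **Hasse transfer across the blow-up substitution.**  For every `γ ≠ 0`,
`φ(D^{(γ)}F) · y_j^{|γ|}` lies in the ideal generated by the `D^{(β)}(φ F)`, `0 < |β| ≤ |γ|`
(unitriangular extraction from `coeff_taylor_identity`, by induction on `(|γ|, γ_j)`). [folklore] -/
theorem map_hasseDeriv_mul_X_pow_mem_span (j : Fin 4) (b : Fin 4 → K)
    (φ : MvPolynomial (Fin 4) K →ₐ[K] MvPolynomial (Fin 4) K) (hφj : φ (X j) = X j)
    (hφi : ∀ i, i ≠ j → φ (X i) = X j * (X i + C (b i))) (F : MvPolynomial (Fin 4) K)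
    {γ : Fin 4 →₀ ℕ} (hγ : γ ≠ 0) :
    φ (Resolution.hasseDeriv K γ F) * X j ^ γ.degree ∈
      Ideal.span {g | ∃ β : Fin 4 →₀ ℕ, 0 < β.degree ∧ β.degree ≤ γ.degree ∧
        g = Resolution.hasseDeriv K β (φ F)} := by
  classical
  suffices H : ∀ n m (γ : Fin 4 →₀ ℕ), γ.degree = n → γ j = m → γ ≠ 0 →
      φ (Resolution.hasseDeriv K γ F) * X j ^ γ.degree ∈
        Ideal.span {g | ∃ β : Fin 4 →₀ ℕ, 0 < β.degree ∧ β.degree ≤ γ.degree ∧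
          g = Resolution.hasseDeriv K β (φ F)} from H _ _ γ rfl rfl hγ
  intro n
  induction n using Nat.strong_induction_on with
  | _ n ihn =>
  intro m
  induction m using Nat.strong_induction_on with
  | _ m ihm =>
  intro γ hn hm hγ0
  set S := (Resolution.taylor K F).support with hS
  set I : Ideal (MvPolynomial (Fin 4) K) := Ideal.span {g | ∃ β : Fin 4 →₀ ℕ, 0 < β.degree ∧
    β.degree ≤ γ.degree ∧ g = Resolution.hasseDeriv K β (φ F)} with hI
  have key := coeff_taylor_identity j b φ hφj hφi F γ
  -- every term with `α ≠ γ` lies in `I`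
  have hterm : ∀ α ∈ S.erase γ,
      (φ (Resolution.hasseDeriv K α F) * X j ^ α.degree) *
        coeff γ (∏ i, (if i = j then (X j : MvPolynomial (Fin 4) (MvPolynomial (Fin 4) K))
          else X i + C (X i + C (b i)) * X j + X i * X j) ^ α i) ∈ I := by
    intro α hα
    obtain ⟨hαγ, -⟩ := Finset.mem_erase.mp hα
    by_cases hc : coeff γ (∏ i, (if i = j then (X j : MvPolynomial (Fin 4) (MvPolynomial (Fin 4) K))
        else X i + C (X i + C (b i)) * X j + X i * X j) ^ α i) = 0
    · rw [hc, mul_zero]; exact I.zero_mem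
    have hlt := (hvProd_triangular j b α).2 γ hc (Ne.symm hαγ)
    have hα0 : α ≠ 0 := by
      rintro rfl
      apply hc
      simp only [Finsupp.coe_zero, Pi.zero_apply, pow_zero, Finset.prod_const_one, coeff_one,
        if_neg (Ne.symm hγ0)]
    refine I.mul_mem_right _ ?_
    have hsub : Ideal.span {g | ∃ β : Fin 4 →₀ ℕ, 0 < β.degree ∧ β.degree ≤ α.degree ∧
        g = Resolution.hasseDeriv K β (φ F)} ≤ I := by
      apply Ideal.span_mono
      rintro g ⟨β, h1, h2, rfl⟩
      exact ⟨β, h1, by omega, rfl⟩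
    apply hsub
    rcases hlt with hlt | ⟨hlt1, hlt2⟩
    · exact ihn α.degree (by omega) (α j) α rfl rfl hα0
    · exact ihm (α j) (by omega) α (by omega) rfl hα0
  by_cases hγS : γ ∈ S
  · rw [← Finset.add_sum_erase S _ hγS, (hvProd_triangular j b γ).1, mul_one] at key
    have hsum := I.sum_mem hterm
    have hrhs : Resolution.hasseDeriv K γ (φ F) * X j ^ (γ j) ∈ I :=
      I.mul_mem_right _ (Ideal.subset_span ⟨γ, by
        rw [pos_iff_ne_zero, Ne, Finsupp.degree_eq_zero_iff]; exact hγ0, le_rfl, rfl⟩)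
    have heq : φ (Resolution.hasseDeriv K γ F) * X j ^ γ.degree =
        Resolution.hasseDeriv K γ (φ F) * X j ^ (γ j) -
          ∑ α ∈ S.erase γ, (φ (Resolution.hasseDeriv K α F) * X j ^ α.degree) *
            coeff γ (∏ i, (if i = j then (X j : MvPolynomial (Fin 4) (MvPolynomial (Fin 4) K))
              else X i + C (X i + C (b i)) * X j + X i * X j) ^ α i) := by
      rw [← key]; ring
    rw [heq]
    exact I.sub_mem hrhs hsum
  · have h0 : Resolution.hasseDeriv K γ F = 0 := by
      rw [Resolution.hasseDeriv_apply]; exact notMem_support_iff.mp hγS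
    rw [h0, map_zero, zero_mul]
    exact I.zero_mem

end BlowupHasse

end Summit.ResolutionOfSingularities.ResolutionOfSingularities.Theorems.PIDim4
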